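import Literature.Geometry.Symplectic.SteinOneHandlebodies
import Literature.Geometry.Symplectic.SteinBall
import Literature.Geometry.Symplectic.FlatLeviNormSq
import Literature.Topology.FourManifolds.LefschetzBaseProfileChange
import HarnessLib

/-!
# Cauchy–Riemann identities and flat Levi forms on the Lefschetz base `ℂ² = ℝ⁴`

Topic `Literature/Geometry/Symplectic`; a proofs-only file (no definition, no named fact) towards
the handle-free base case of `Literature.Geometry.Symplectic.palf_stein_supportedByBoundaryOpenBook`
in the form `palf_stein_supportedByBoundaryOpenBook_of_reebModels`
(`LefschetzSteinOpenBookReeb.lean`):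
the Stein model of `F_{g,1} × D²` is a regular sublevel set `{Ψ ≤ 1/4} ⊂ ℂ²` of
`Ψ = ‖w‖² + Θ(‖x‖²) + ε ‖x‖² + ε δ m(‖y‖²)` (`LefschetzBaseModelIdentification.lean`), and its
Stein structure is the restriction of the standard complex structure `J₀` of `ℂ²`
(`stdComplexStructure`, `SteinBall.lean`) with `J`-convex function `Ψ|` — provided the flat Levi
form `L_Ψ(u) = D²Ψ(u,u) + D²Ψ(J₀u,J₀u)` is positive (`SteinOneHandlebodies.lean`, §3–4).  Here:

* §1 `J₀` in the complex coordinates `(x, y) = (cx, cy)` of `LefschetzBaseModel.lean`: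
  `cx (J₀ v) = i cx v`, `cy (J₀ v) = i cy v`, `J₀ v = mk (i cx v) (i cy v)`; the derivative
  `Dw_z(v) = 2 y cy(v) - (2g+1) x^{2g} cx(v)` of `w = y² - x^{2g+1} - 1` as a Fréchet derivative
  (`fderiv_w_apply`) and the **Cauchy–Riemann identities** `D(cx)(J₀v) = i D(cx)(v)`,
  `D(cy)(J₀v) = i D(cy)(v)`, `Dw(J₀v) = i Dw(v)` (`w` is a holomorphic polynomial).
* §2 The flat Levi forms of the building blocks (from `FlatLeviNormSq.lean`):
  `L_{‖w‖²}(u) = 4 ‖Dw u‖²`, `L_{‖x‖²}(u) = 4 ‖cx u‖²`,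
  `L_{Θ(‖x‖²)}(u) = 4 (Θ' + s Θ'') ‖cx u‖²` (`s = ‖x‖²`), `L_{m(‖y‖²)}(u) = 4 (m' + t m'') ‖cy u‖²`
  (`t = ‖y‖²`); additivity and homogeneity of `L` in `Ψ` (`leviFlat_add`, `leviFlat_const_mul`).
* §3 `exists_steinStructure_sublevel_of_levi_pos` — **a compact regular sublevel set
  `{Ψ ≤ c} ⊂ ℝ⁴` on which the flat Levi form of `Ψ` for a constant complex structure `J₀`
  (`J₀² = -1`) is positive definite carries the Stein structure `(J₀|, Ψ|)`** — the recipe of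
  `exists_steinStructure_fourThickening` (`SteinOneHandlebodies.lean`, §4–5) for a general `Ψ`
  (Cieliebak–Eliashberg 2012, Ch. 2; Grauert 1958: regular sublevel sets of strictly
  plurisubharmonic exhaustions are Stein domains).

## References

* K. Cieliebak, Ya. Eliashberg, *From Stein to Weinstein and Back*, AMS Coll. Publ. 59 (2012),
  Ch. 2 (`J`-convex functions: `|f|²` for holomorphic `f`, `φ(|z|²)`). [CieliebakEliashberg2012]
* R. E. Gompf, *Handlebody construction of Stein surfaces*, Ann. of Math. 148 (1998), §1–2.
  [Gompf1998]
-/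

noncomputable section

open scoped Manifold ContDiff Topology RealInnerProductSpace ComplexConjugate
open Set Function Complex

namespace Literature.Geometry.Symplectic

open Literature.Topology.FourManifolds Literature.Topology.FourManifolds.LefschetzBase

/-! ### §1 `J₀` in complex coordinates; Cauchy–Riemann identities -/

/-- `x(J₀ v) = i x(v)`. [folklore] -/
@[simp] theorem cx_stdComplexStructure (v : EuclideanSpace ℝ (Fin 4)) :
    cx (stdComplexStructure v) = I * cx v := by
  apply Complex.ext <;> simp [cx]

/-- `y(J₀ v) = i y(v)`. [folklore] -/
@[simp] theorem cy_stdComplexStructure (v : EuclideanSpace ℝ (Fin 4)) :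
    cy (stdComplexStructure v) = I * cy v := by
  apply Complex.ext <;> simp [cy]

/-- `J₀ v = (i x(v), i y(v))`: `J₀` is multiplication by `i` on `ℂ²`. [folklore] -/
theorem stdComplexStructure_eq_mk (v : EuclideanSpace ℝ (Fin 4)) :
    stdComplexStructure v = mk (I * cx v) (I * cy v) := by
  rw [← mk_cx_cy (stdComplexStructure v), cx_stdComplexStructure, cy_stdComplexStructure]

/-- `cxL (J₀ v) = i cxL v`. [folklore] -/
theorem cxL_stdComplexStructure (v : EuclideanSpace ℝ (Fin 4)) :
    cxL (stdComplexStructure v) = I * cxL v := by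
  simp

/-- `cyL (J₀ v) = i cyL v`. [folklore] -/
theorem cyL_stdComplexStructure (v : EuclideanSpace ℝ (Fin 4)) :
    cyL (stdComplexStructure v) = I * cyL v := by
  simp

/-- The Fréchet derivative of the coordinate `x` is `cxL`. [folklore] -/
theorem fderiv_cx (z : EuclideanSpace ℝ (Fin 4)) : fderiv ℝ cx z = cxL := by
  rw [cx_eq]; exact cxL.fderiv

/-- The Fréchet derivative of the coordinate `y` is `cyL`. [folklore] -/
theorem fderiv_cy (z : EuclideanSpace ℝ (Fin 4)) : fderiv ℝ cy z = cyL := by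
  rw [cy_eq]; exact cyL.fderiv

/-- **Cauchy–Riemann for `x`**: `D(cx)_z(J₀ v) = i D(cx)_z(v)`. [folklore] -/
theorem fderiv_cx_stdComplexStructure (z v : EuclideanSpace ℝ (Fin 4)) :
    fderiv ℝ cx z (stdComplexStructure v) = I * fderiv ℝ cx z v := by
  rw [fderiv_cx]; exact cxL_stdComplexStructure v

/-- **Cauchy–Riemann for `y`**: `D(cy)_z(J₀ v) = i D(cy)_z(v)`. [folklore] -/
theorem fderiv_cy_stdComplexStructure (z v : EuclideanSpace ℝ (Fin 4)) :
    fderiv ℝ cy z (stdComplexStructure v) = I * fderiv ℝ cy z v := by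
  rw [fderiv_cy]; exact cyL_stdComplexStructure v

/-- **`dw = 2y dy - (2g+1) x^{2g} dx`** as a Fréchet derivative:
`Dw_z(v) = 2 cy(v) cy(z) - (2g+1) cx(z)^{2g} cx(v)`. [folklore] -/
theorem fderiv_w_apply (g : ℕ) (z v : EuclideanSpace ℝ (Fin 4)) :
    fderiv ℝ (w g) z v = 2 * cy v * cy z - (2 * g + 1 : ℕ) * cx z ^ (2 * g) * cx v := by
  have hl : HasDerivAt (fun t : ℝ => z + t • mk (cx v) (cy v)) (mk (cx v) (cy v)) 0 := by
    have h := ((hasDerivAt_id (0 : ℝ)).smul_const (mk (cx v) (cy v))).const_add z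
    rwa [one_smul] at h
  have h1 : HasDerivAt (fun t : ℝ => w g (z + t • mk (cx v) (cy v)))
      (fderiv ℝ (w g) z (mk (cx v) (cy v))) 0 := by
    have h := (((contDiff_w g).differentiable (by simp)) (z + (0 : ℝ) • mk (cx v) (cy v)))
      |>.hasFDerivAt.comp_hasDerivAt (0 : ℝ) hl
    rw [zero_smul, add_zero] at h
    exact h
  have h2 := h1.unique (hasDerivAt_w_line g z (cx v) (cy v))
  rwa [mk_cx_cy] at h2

/-- **Cauchy–Riemann for `w`**: `Dw_z(J₀ v) = i Dw_z(v)` (`w` is a holomorphic polynomial in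
`(x, y)`). [folklore] -/
theorem fderiv_w_stdComplexStructure (g : ℕ) (z v : EuclideanSpace ℝ (Fin 4)) :
    fderiv ℝ (w g) z (stdComplexStructure v) = I * fderiv ℝ (w g) z v := by
  rw [fderiv_w_apply, fderiv_w_apply, cx_stdComplexStructure, cy_stdComplexStructure]
  ring

/-- `Dw_z(v) = 0` iff `2 y cy(v) = (2g+1) x^{2g} cx(v)`. [folklore] -/
theorem fderiv_w_apply_eq_zero_iff (g : ℕ) (z v : EuclideanSpace ℝ (Fin 4)) :
    fderiv ℝ (w g) z v = 0 ↔ 2 * cy v * cy z = (2 * g + 1 : ℕ) * cx z ^ (2 * g) * cx v := by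
  rw [fderiv_w_apply, sub_eq_zero]

/-! ### §2 Flat Levi forms of the building blocks -/

/-- **`L_{‖w‖²}(u) = 4 ‖Dw_z u‖²`**: `‖w‖²` is `J₀`-plurisubharmonic, strictly in the directions
not killed by `dw`. [cite: CieliebakEliashberg2012, Ch. 2] -/
theorem levi_norm_sq_w (g : ℕ) (z u : EuclideanSpace ℝ (Fin 4)) :
    fderiv ℝ (fderiv ℝ fun y => ‖w g y‖ ^ 2) z u u +
        fderiv ℝ (fderiv ℝ fun y => ‖w g y‖ ^ 2) z (stdComplexStructure u) (stdComplexStructure u) =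
      4 * ‖fderiv ℝ (w g) z u‖ ^ 2 :=
  levi_norm_sq_of_cauchyRiemann stdComplexStructure ((contDiff_w g).of_le (by norm_cast))
    (fderiv_w_stdComplexStructure g) z u

/-- **`L_{‖x‖²}(u) = 4 ‖cx u‖²`**. [cite: CieliebakEliashberg2012, Ch. 2] -/
theorem levi_norm_sq_cx (z u : EuclideanSpace ℝ (Fin 4)) :
    fderiv ℝ (fderiv ℝ fun y => ‖cx y‖ ^ 2) z u u +
        fderiv ℝ (fderiv ℝ fun y => ‖cx y‖ ^ 2) z (stdComplexStructure u) (stdComplexStructure u) =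
      4 * ‖cx u‖ ^ 2 := by
  rw [levi_norm_sq_of_cauchyRiemann stdComplexStructure (contDiff_cx.of_le (by norm_cast))
    fderiv_cx_stdComplexStructure z u, fderiv_cx, cxL_apply]

/-- **`L_{‖y‖²}(u) = 4 ‖cy u‖²`**. [cite: CieliebakEliashberg2012, Ch. 2] -/
theorem levi_norm_sq_cy (z u : EuclideanSpace ℝ (Fin 4)) :
    fderiv ℝ (fderiv ℝ fun y => ‖cy y‖ ^ 2) z u u +
        fderiv ℝ (fderiv ℝ fun y => ‖cy y‖ ^ 2) z (stdComplexStructure u) (stdComplexStructure u) =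
      4 * ‖cy u‖ ^ 2 := by
  rw [levi_norm_sq_of_cauchyRiemann stdComplexStructure (contDiff_cy.of_le (by norm_cast))
    fderiv_cy_stdComplexStructure z u, fderiv_cy, cyL_apply]

/-- **`L_{Θ(‖x‖²)}(u) = 4 (Θ'(s) + s Θ''(s)) ‖cx u‖²`, `s = ‖x‖²`** — non-negative when
`Θ' + s Θ'' ≥ 0` (e.g. `Θ = convexProfile`, `levi_coeff_convexProfile_nonneg`).
[cite: CieliebakEliashberg2012, Ch. 2] -/
theorem levi_comp_norm_sq_cx {Θ : ℝ → ℝ} (hΘ : ContDiff ℝ 2 Θ) (z u : EuclideanSpace ℝ (Fin 4)) :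
    fderiv ℝ (fderiv ℝ fun y => Θ (‖cx y‖ ^ 2)) z u u +
        fderiv ℝ (fderiv ℝ fun y => Θ (‖cx y‖ ^ 2)) z (stdComplexStructure u)
          (stdComplexStructure u) =
      4 * (deriv Θ (‖cx z‖ ^ 2) + ‖cx z‖ ^ 2 * deriv (deriv Θ) (‖cx z‖ ^ 2)) * ‖cx u‖ ^ 2 := by
  have h := levi_comp_norm_sq_of_linear stdComplexStructure cxL cxL_stdComplexStructure hΘ z u
  simpa only [cxL_apply] using h

/-- **`L_{m(‖y‖²)}(u) = 4 (m'(t) + t m''(t)) ‖cy u‖²`, `t = ‖y‖²`**.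
[cite: CieliebakEliashberg2012, Ch. 2] -/
theorem levi_comp_norm_sq_cy {m : ℝ → ℝ} (hm : ContDiff ℝ 2 m) (z u : EuclideanSpace ℝ (Fin 4)) :
    fderiv ℝ (fderiv ℝ fun y => m (‖cy y‖ ^ 2)) z u u +
        fderiv ℝ (fderiv ℝ fun y => m (‖cy y‖ ^ 2)) z (stdComplexStructure u)
          (stdComplexStructure u) =
      4 * (deriv m (‖cy z‖ ^ 2) + ‖cy z‖ ^ 2 * deriv (deriv m) (‖cy z‖ ^ 2)) * ‖cy u‖ ^ 2 := by
  have h := levi_comp_norm_sq_of_linear stdComplexStructure cyL cyL_stdComplexStructure hm z u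
  simpa only [cyL_apply] using h

/-! #### Additivity and homogeneity of the second derivative in the function -/

section Algebra

variable {E : Type*} [NormedAddCommGroup E] [NormedSpace ℝ E]

/-- `D²(f₁ + f₂)(u, v) = D²f₁(u, v) + D²f₂(u, v)` for `C²` functions. [folklore] -/
theorem fderiv_fderiv_add_apply {f₁ f₂ : E → ℝ} (h₁ : ContDiff ℝ 2 f₁) (h₂ : ContDiff ℝ 2 f₂)
    (z u v : E) :
    fderiv ℝ (fderiv ℝ fun y => f₁ y + f₂ y) z u v =
      fderiv ℝ (fderiv ℝ f₁) z u v + fderiv ℝ (fderiv ℝ f₂) z u v := by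
  have hsum : fderiv ℝ (fun y => f₁ y + f₂ y) = fun y => fderiv ℝ f₁ y + fderiv ℝ f₂ y :=
    funext fun y => fderiv_add ((h₁.differentiable (by simp)) y) ((h₂.differentiable (by simp)) y)
  have hD₁ : DifferentiableAt ℝ (fderiv ℝ f₁) z :=
    ((h₁.contDiffAt (x := z)).fderiv_right (m := 1) (by norm_num)).differentiableAt one_ne_zero
  have hD₂ : DifferentiableAt ℝ (fderiv ℝ f₂) z :=
    ((h₂.contDiffAt (x := z)).fderiv_right (m := 1) (by norm_num)).differentiableAt one_ne_zero
  rw [hsum, fderiv_fun_add hD₁ hD₂]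
  rfl

/-- `D²(c f)(u, v) = c D²f(u, v)` for a `C²` function. [folklore] -/
theorem fderiv_fderiv_const_mul_apply {f : E → ℝ} (hf : ContDiff ℝ 2 f) (c : ℝ) (z u v : E) :
    fderiv ℝ (fderiv ℝ fun y => c * f y) z u v = c * fderiv ℝ (fderiv ℝ f) z u v := by
  have hmul : fderiv ℝ (fun y => c * f y) = fun y => c • fderiv ℝ f y :=
    funext fun y => fderiv_const_mul ((hf.differentiable (by simp)) y) c
  have hD : DifferentiableAt ℝ (fderiv ℝ f) z :=
    ((hf.contDiffAt (x := z)).fderiv_right (m := 1) (by norm_num)).differentiableAt one_ne_zero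
  rw [hmul, fderiv_fun_const_smul hD]
  rfl

/-- **Additivity of the flat Levi form**: `L_{f₁ + f₂} = L_{f₁} + L_{f₂}`. [folklore] -/
theorem leviFlat_add (J₀ : E →L[ℝ] E) {f₁ f₂ : E → ℝ} (h₁ : ContDiff ℝ 2 f₁) (h₂ : ContDiff ℝ 2 f₂)
    (z u : E) :
    fderiv ℝ (fderiv ℝ fun y => f₁ y + f₂ y) z u u +
        fderiv ℝ (fderiv ℝ fun y => f₁ y + f₂ y) z (J₀ u) (J₀ u) =
      (fderiv ℝ (fderiv ℝ f₁) z u u + fderiv ℝ (fderiv ℝ f₁) z (J₀ u) (J₀ u)) +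
        (fderiv ℝ (fderiv ℝ f₂) z u u + fderiv ℝ (fderiv ℝ f₂) z (J₀ u) (J₀ u)) := by
  rw [fderiv_fderiv_add_apply h₁ h₂, fderiv_fderiv_add_apply h₁ h₂]
  ring

/-- **Homogeneity of the flat Levi form**: `L_{c f} = c L_f`. [folklore] -/
theorem leviFlat_const_mul (J₀ : E →L[ℝ] E) {f : E → ℝ} (hf : ContDiff ℝ 2 f) (c : ℝ) (z u : E) :
    fderiv ℝ (fderiv ℝ fun y => c * f y) z u u +
        fderiv ℝ (fderiv ℝ fun y => c * f y) z (J₀ u) (J₀ u) =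
      c * (fderiv ℝ (fderiv ℝ f) z u u + fderiv ℝ (fderiv ℝ f) z (J₀ u) (J₀ u)) := by
  rw [fderiv_fderiv_const_mul_apply hf, fderiv_fderiv_const_mul_apply hf]
  ring

end Algebra

/-! ### §3 Stein structures on compact regular sublevel sets with positive flat Levi form -/

/-- **A compact regular sublevel set `{Ψ ≤ c} ⊂ ℝ⁴` with positive definite flat Levi form is a
Stein domain for `(J₀|, Ψ|)`.**  For a constant complex structure `J₀` of `ℝ⁴` (`J₀² = -1`), a
regular value `c` of `Ψ` with nonempty level `{Ψ = c}` and compact `{Ψ ≤ c}`, if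
`D²Ψ_z(u, u) + D²Ψ_z(J₀u, J₀u) > 0` for all `z` with `Ψ z ≤ c` and `u ≠ 0`, then the transported
structure `J = sublevelJ` with `φ = Ψ ∘ incl` is a Stein structure on `RegularSublevel h` in the
tree's sense (`SteinStructure`: integrable by `nijenhuis_sublevelJ_eq_zero`, `J`-convex by
`neg_mextDeriv_dComplex_sublevel_self`, boundary `= {φ = max φ}` regular).  The recipe of
`exists_steinStructure_fourThickening` for a general defining function (Cieliebak–Eliashberg
2012, Ch. 2; Grauert 1958). [cite: CieliebakEliashberg2012, Ch. 2] -/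
theorem exists_steinStructure_sublevel_of_levi_pos {Ψ : EuclideanSpace ℝ (Fin 4) → ℝ} {c : ℝ}
    (h : IsRegularLevel (𝓡 4) Ψ c) [CompactSpace (RegularSublevel h)]
    (J₀ : EuclideanSpace ℝ (Fin 4) →L[ℝ] EuclideanSpace ℝ (Fin 4))
    (hJ : ∀ v, J₀ (J₀ v) = -v) (hne : ∃ w, Ψ w = c)
    (hpos : ∀ z, Ψ z ≤ c → ∀ u : EuclideanSpace ℝ (Fin 4), u ≠ 0 →
      0 < fderiv ℝ (fderiv ℝ Ψ) z u u + fderiv ℝ (fderiv ℝ Ψ) z (J₀ u) (J₀ u)) :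
    ∃ S : SteinStructure (RegularSublevel h), S.φ = sublevelPhi h ∧ S.J = sublevelJ h J₀ := by
  refine ⟨{ J := sublevelJ h J₀
            φ := sublevelPhi h
            J_sq := sublevelJ_sq _ _ hJ
            J_smooth := isSmoothVectorField_sublevelJ _ _
            integrable := fun X Y hX hY x => nijenhuis_sublevelJ_eq_zero _ _ hJ hX hY x
            φ_smooth := contMDiff_sublevelPhi _
            convex := fun x v hv => ?_
            boundary_eq := isBoundaryPoint_iff_sublevelPhi_eq_sSup _ hne
            regular := fun x hx => mfderiv_sublevelPhi_ne_zero _ hx }, rfl, rfl⟩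
  rw [neg_mextDeriv_dComplex_sublevel_self _ _ hJ]
  have hu : inclDeriv h x v ≠ 0 := fun h0 => hv ((inclDeriv h x).map_eq_zero_iff.1 h0)
  exact hpos _ (RegularSublevel.apply_incl_le h x) _ hu

/-- The same, packaged as `IsSteinDomain`. [cite: CieliebakEliashberg2012, Ch. 2] -/
theorem isSteinDomain_sublevel_of_levi_pos {Ψ : EuclideanSpace ℝ (Fin 4) → ℝ} {c : ℝ}
    (h : IsRegularLevel (𝓡 4) Ψ c) [CompactSpace (RegularSublevel h)]
    (J₀ : EuclideanSpace ℝ (Fin 4) →L[ℝ] EuclideanSpace ℝ (Fin 4))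
    (hJ : ∀ v, J₀ (J₀ v) = -v) (hne : ∃ w, Ψ w = c)
    (hpos : ∀ z, Ψ z ≤ c → ∀ u : EuclideanSpace ℝ (Fin 4), u ≠ 0 →
      0 < fderiv ℝ (fderiv ℝ Ψ) z u u + fderiv ℝ (fderiv ℝ Ψ) z (J₀ u) (J₀ u)) :
    IsSteinDomain (RegularSublevel h) := by
  obtain ⟨S, -, -⟩ := exists_steinStructure_sublevel_of_levi_pos h J₀ hJ hne hpos
  exact ⟨S⟩

end Literature.Geometry.Symplectic

end
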